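/-
Copyright (c) 2026 the pub-hodgecm-mathlib formalisation cell (harness21).  Prover seat hodgecm-mathlib-A-p06 (g29) — (U) road, U4-DISCHARGE brick (b3)-(ii) «null complement + exhaustion», FILE 1 «the Cayley-singular locus is null»
(LEAD F0P3a-plan (g10) WORDS T9-40 (d1) ∕ T9-41 (3); owner A-p19 (g24); split with A-p12 (g20) (b3)-(i)(iii) and F0P3-p03 (g11) (d2) 13:31Z).
-/
import Literature.NumberTheory.Weil1964.UnitaryArchLocalTopFormHaar     -- ★ U1 FILE B (A-p06 g28): `skewC`, `cayleySourceC`, `cayleyChartC`, `cayleyInvC`, `cayleyWeightC`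
import Literature.NumberTheory.Automorphic.ArchDiagonalTorus             -- ★ `circleDiagonal`, `coe_circleDiagonal`, `continuous_circleDiagonal`
import Mathlib.LinearAlgebra.Matrix.Charpoly.Coeff
import Mathlib.Analysis.SpecialFunctions.Complex.Circle
import Mathlib.Order.Interval.Set.Infinite
import HarnessLib

/-!
# The Cayley-singular locus of `U(Jw)(ℂ)` is Haar-null, and the complement of the Cayley chart source in `𝔲(Jw)` is Lebesgue-null — by COUNTING eigenvalues
# ((U) road, U4-DISCHARGE brick (b3)-(ii), FILE 1 of 2; Weyl 1939 Ch. II §10; Helgason 2000 Ch. I §1 Thm. 1.14)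

Topic `NumberTheory/Weil1964` (the D-T ∕ (U) road's measure bricks), namespace `Literature.NumberTheory.Weil1964.UnitaryArchLocalTopForm` (that of ★ U1 FILES A∕B∕C).
THEOREMS ONLY: no definition, no named fact (net debt 0), no instance, no notation, no `sorry`.  Cell `pub/hodgecm-mathlib`, crux H413 = `stmt-HodgeConjecture-24833`
(supports only).  GENERIC over the one-place form `Jw ∈ M_N(ℂ)` — no CM field, no slicing, no non-degeneracy hypothesis.  Consumer: FILE 2 `UnitaryArchLocalCayleyExhaustion`
(`μ(U(Jw)(ℂ)) = ∫_{𝔲(Jw)} w₀ dλ` from an any-window identity) and, through it, the in-house discharge of U4 `ArchTopFormWallCompatible` (A-p12 (g20) (b3)-(iii) values,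
F0P3-p03 (g11) (d2) congruence transport).
HONEST LABEL: HC_CM is proved only modulo the 2 remaining named inputs (hLiu418 24832, h413 24833) until rung 0 closes; this file discharges no printed statement.

THE ARGUMENT (a COUNTING argument — no analytic-null-set theory, no manifold structure).
* §1 `sum_measure_le_mul_of_card_filter_le`: measurable sets `A i ⊆ C` (`i ∈ s`) covering every point at most `N` times have `∑ μ(A i) ≤ N · μ(C)`; and `(k · m ≤ c < ∞ ∀ k) ⇒ m = 0`.
* §2 `card_filter_not_isUnit_smul_one_add_le`: for `G ∈ M_N(ℂ)` and an injective `φ : ι → ℂ`, `#{i ∈ s | φ i · 1 + G singular} ≤ N` (roots of `charpoly (−G)`: Mathlib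
  `Matrix.eval_charpoly`, `Polynomial.card_roots'`).
* §3 THE GROUP: `Z = {g ∈ U(Jw)(ℂ) | 1 + g singular}` is NULL for EVERY left-invariant measure finite on compacta (`measure_setOf_not_isUnit_one_add_eq_zero`): the central circle
  `ζ·1 ∈ U(Jw)` translates `Z ∩ C` to `k` sets of the same measure inside the compact `S¹·C`, each `g` lying in at most `N` of them (`det(ζ·1 + g) = 0`) ⇒
  `k·μ(Z ∩ C) ≤ N·μ(S¹·C)` for all `k`; σ-compactness.  Hence `μ (ĉ '' cayleySourceC)ᶜ = 0` and `μ(univ) = μ(ĉ '' cayleySourceC)` (★ `image_cayleyChartC_eq`: the chart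
  image IS `{1 + g invertible}`).
* §4 THE LIE ALGEBRA: `lam (cayleySourceC)ᶜ = 0` for every translation-invariant `lam` finite on compacta on `𝔲(Jw)` (translations by `t·i·1 ∈ 𝔲(Jw)`, same count), hence
  `∫_{source} f dλ = ∫_{𝔲(Jw)} f dλ`.

## References
* H. Weyl, *The Classical Groups, their Invariants and Representations*, Princeton (1939), Ch. II §10 (Cayley parametrisation; the exceptional `det(1 + g) = 0`). [Weyl1939]
* S. Helgason, *Groups and Geometric Analysis*, AMS Math. Surveys Monogr. 83 (2000), Ch. I §1 Thm. 1.14 p. 96. [Helgason2000]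
* A. W. Knapp, *Lie Groups Beyond an Introduction*, 2nd ed., Birkhäuser (2002), VIII §2 (Haar measure in coordinates). [Knapp2002]
-/

set_option autoImplicit false
-- the scoped normed structure on the submodule `𝔲(Jw) ≤ M_N(ℂ)` is only reducibly defeq to the subtype uniformity ∕ topology carried by the
-- `[BorelSpace ↥(skewC …)]` binder (as in ★ U1 FILES A∕B)
set_option backward.isDefEq.respectTransparency false

noncomputable section

open Set Filter Topology MeasureTheory MeasureTheory.Measure Literature.Analysis.Calculus Polynomial
open scoped Classical Matrix Matrix.Norms.Operator MatrixGroups ENNReal NNReal Pointwise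

namespace Literature.NumberTheory.Weil1964

namespace UnitaryArchLocalTopForm

open Literature.NumberTheory.Automorphic Literature.NumberTheory.Automorphic.UnitaryGroup

/-! ## §1 Finite-overlap counting -/

section Counting

variable {α ι : Type*} [MeasurableSpace α]

/-- **Finite-overlap counting.**  If the measurable sets `A i ⊆ C` (`i ∈ s`, `C` measurable) cover every point at most `N` times, then `∑_{i ∈ s} μ(A i) ≤ N · μ(C)`
(integrate `∑ 1_{A i} ≤ N · 1_C`). [cite: Knapp2002, VIII §2] -/
theorem sum_measure_le_mul_of_card_filter_le (μ : Measure α) (s : Finset ι) (A : ι → Set α) {C : Set α} (hC : MeasurableSet C)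
    (hA : ∀ i ∈ s, MeasurableSet (A i)) (hsub : ∀ i ∈ s, A i ⊆ C) (N : ℕ) (hN : ∀ x, (s.filter fun i => x ∈ A i).card ≤ N) :
    ∑ i ∈ s, μ (A i) ≤ (N : ℝ≥0∞) * μ C := by
  calc ∑ i ∈ s, μ (A i) = ∑ i ∈ s, ∫⁻ x, (A i).indicator 1 x ∂μ := Finset.sum_congr rfl fun i hi => (lintegral_indicator_one (hA i hi)).symm
    _ = ∫⁻ x, ∑ i ∈ s, (A i).indicator 1 x ∂μ := (lintegral_finsetSum' _ fun i hi => (measurable_one.indicator (hA i hi)).aemeasurable).symm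
    _ ≤ ∫⁻ x, C.indicator (fun _ => (N : ℝ≥0∞)) x ∂μ := by
        refine lintegral_mono fun x => ?_
        by_cases hx : x ∈ C
        · rw [Set.indicator_of_mem hx]
          have hsum : ∑ i ∈ s, (A i).indicator (1 : α → ℝ≥0∞) x = ((s.filter fun i => x ∈ A i).card : ℝ≥0∞) := by
            rw [← Finset.sum_boole]
            exact Finset.sum_congr rfl fun i _ => by simp only [Set.indicator_apply, Pi.one_apply]
          rw [hsum]
          exact Nat.mono_cast (hN x)
        · rw [Set.indicator_of_notMem hx, Finset.sum_eq_zero fun i hi => Set.indicator_of_notMem (fun h => hx (hsub i hi h)) _]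
    _ = (N : ℝ≥0∞) * μ C := lintegral_indicator_const hC _

/-- `k · m ≤ c` for every `k : ℕ` with `c < ∞` forces `m = 0`. [cite: Knapp2002, VIII §2] -/
theorem eq_zero_of_forall_nat_mul_le {m c : ℝ≥0∞} (hc : c ≠ ⊤) (h : ∀ k : ℕ, (k : ℝ≥0∞) * m ≤ c) : m = 0 := by
  by_contra hm
  obtain ⟨k, hk⟩ := ENNReal.exists_nat_mul_gt hm hc
  exact lt_irrefl _ (hk.trans_le (h k))

end Counting

/-! ## §2 At most `N` scalars `ζ` make `ζ · 1 + G` singular -/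

section Eigen

variable {N : ℕ}

/-- **At most `N` exceptional scalars**: for `G ∈ M_N(ℂ)` and an injective `φ : ι → ℂ`, the `i ∈ s` with `φ i · 1 + G` singular number at most `N` — they are roots of the
monic degree-`N` polynomial `charpoly (−G)` (`det(t·1 + G) = charpoly(−G)(t)`). [cite: Weyl1939, Ch. II §10] -/
theorem card_filter_not_isUnit_smul_one_add_le {ι : Type*} (φ : ι → ℂ) (hφ : Function.Injective φ) (G : Matrix (Fin N) (Fin N) ℂ) (s : Finset ι) :
    (s.filter fun i => ¬ IsUnit (φ i • (1 : Matrix (Fin N) (Fin N) ℂ) + G)).card ≤ N := by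
  set p : ℂ[X] := (-G).charpoly with hp
  have hp0 : p ≠ 0 := (Matrix.charpoly_monic (-G)).ne_zero
  have hroot : ∀ i ∈ s.filter (fun i => ¬ IsUnit (φ i • (1 : Matrix (Fin N) (Fin N) ℂ) + G)), φ i ∈ p.roots.toFinset := by
    intro i hi
    rw [Finset.mem_filter] at hi
    rw [Multiset.mem_toFinset, Polynomial.mem_roots hp0, Polynomial.IsRoot.def, hp, Matrix.eval_charpoly, sub_neg_eq_add, Matrix.scalar_apply,
      ← Matrix.smul_one_eq_diagonal]
    by_contra hdet
    exact hi.2 ((Matrix.isUnit_iff_isUnit_det _).2 (isUnit_iff_ne_zero.2 hdet))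
  calc (s.filter fun i => ¬ IsUnit (φ i • (1 : Matrix (Fin N) (Fin N) ℂ) + G)).card
      ≤ p.roots.toFinset.card := Finset.card_le_card_of_injOn φ hroot (hφ.injOn)
    _ ≤ Multiset.card p.roots := Multiset.toFinset_card_le _
    _ ≤ p.natDegree := Polynomial.card_roots' _
    _ = N := by rw [hp, Matrix.charpoly_natDegree_eq_dim, Fintype.card_fin]

/-- `det(ζ·1 + G) = 0` from `det(1 + ζ⁻¹·G) = 0` (`ζ ≠ 0`): `ζ·1 + G = ζ · (1 + ζ⁻¹·G)`. [cite: Weyl1939, Ch. II §10] -/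
theorem not_isUnit_smul_one_add_of_not_isUnit {ζ : ℂ} (hζ : ζ ≠ 0) {G : Matrix (Fin N) (Fin N) ℂ} (h : ¬ IsUnit (1 + ζ⁻¹ • G)) :
    ¬ IsUnit (ζ • (1 : Matrix (Fin N) (Fin N) ℂ) + G) := by
  intro hu
  apply h
  have heq : ζ • (1 : Matrix (Fin N) (Fin N) ℂ) + G = ζ • (1 + ζ⁻¹ • G) := by rw [smul_add, smul_smul, mul_inv_cancel₀ hζ, one_smul]
  rw [heq] at hu
  rw [Matrix.isUnit_iff_isUnit_det] at hu ⊢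
  rw [Matrix.det_smul] at hu
  exact isUnit_of_mul_isUnit_right hu

end Eigen

/-! ## §3 The Cayley-singular locus of `U(Jw)(ℂ)` is null for every left-invariant measure finite on compacta -/

section Group

variable {N : ℕ} {Jw : Matrix (Fin N) (Fin N) ℂ}

/-- The central unit scalar `ζ · 1` (`|ζ| = 1`) lies in `U(Jw)(ℂ)` for EVERY `Jw` (`ζ̄ Jw ζ = Jw`). [cite: Weyl1939, Ch. II §10] -/
theorem circleDiagonal_const_mem_unitaryGroupOfForm (ζ : Circle) : circleDiagonal N (fun _ => ζ) ∈ unitaryGroupOfForm (starRingEnd ℂ) Jw := by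
  rw [mem_unitaryGroupOfForm_iff, coe_circleDiagonal]
  have hdiag : (Matrix.diagonal fun _ : Fin N => (ζ : ℂ)) = (ζ : ℂ) • (1 : Matrix (Fin N) (Fin N) ℂ) := (Matrix.smul_one_eq_diagonal _).symm
  have hmap : ((ζ : ℂ) • (1 : Matrix (Fin N) (Fin N) ℂ)).map (starRingEnd ℂ) = (starRingEnd ℂ (ζ : ℂ)) • (1 : Matrix (Fin N) (Fin N) ℂ) := by
    rw [Matrix.map_smul' _ _ _ (fun a b => map_mul (starRingEnd ℂ) a b), Matrix.map_one _ (map_zero _) (map_one _)]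
  have hz : (ζ : ℂ) * starRingEnd ℂ (ζ : ℂ) = 1 := by
    rw [Complex.mul_conj, Circle.normSq_coe, Complex.ofReal_one]
  rw [hdiag, hmap, Matrix.transpose_smul, Matrix.transpose_one, Matrix.smul_mul, Matrix.one_mul, Matrix.mul_smul, Matrix.mul_one, smul_smul, hz, one_smul]

/-- The matrix of `ζ·1 · g` is `ζ • g`. [cite: Weyl1939, Ch. II §10] -/
theorem coe_circleDiagonal_const_mul (ζ : Circle) (g : unitaryGroupOfForm (starRingEnd ℂ) Jw) :
    ((((⟨circleDiagonal N (fun _ => ζ), circleDiagonal_const_mem_unitaryGroupOfForm ζ⟩ : unitaryGroupOfForm (starRingEnd ℂ) Jw) * g :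
        unitaryGroupOfForm (starRingEnd ℂ) Jw) : GL (Fin N) ℂ) : Matrix (Fin N) (Fin N) ℂ) = (ζ : ℂ) • (((g : GL (Fin N) ℂ)) : Matrix (Fin N) (Fin N) ℂ) := by
  rw [Subgroup.coe_mul, Units.val_mul, coe_circleDiagonal, ← Matrix.smul_one_eq_diagonal, Matrix.smul_mul, Matrix.one_mul]

/-- The unit circle is infinite (`Circle.exp` is injective on `[0, 1]`). [cite: Knapp2002, VIII §2] -/
theorem univ_circle_infinite : (Set.univ : Set Circle).Infinite :=
  Set.infinite_of_injOn_mapsTo (Circle.exp_injOn_Icc (a := 0) (b := 1) (by linarith [Real.pi_gt_three])) (Set.mapsTo_univ _ _)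
    (Set.Icc_infinite (zero_lt_one' ℝ))

/-- For `1 + g` invertible, the inverse chart lands in the chart source. [cite: Weyl1939, Ch. II §10] -/
theorem cayleyInvC_mem_cayleySourceC {g : unitaryGroupOfForm (starRingEnd ℂ) Jw} (h : IsUnit (1 + (((g : GL (Fin N) ℂ)) : Matrix (Fin N) (Fin N) ℂ))) :
    cayleyInvC N Jw g ∈ cayleySourceC N Jw := by
  rw [mem_cayleySourceC_iff, coe_cayleyInvC h]
  exact ⟨isUnit_one_add_cayley h, (isUnit_one_sub_cayley_iff h).2 (g : GL (Fin N) ℂ).isUnit⟩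

/-- **The chart image of the source IS the invertibility locus**: `ĉ '' cayleySourceC = {g | 1 + g invertible}` (★ `image_cayleyChartC_eq`). [cite: Weyl1939, Ch. II §10] -/
theorem image_cayleyChartC_cayleySourceC :
    cayleyChartC N Jw '' cayleySourceC N Jw = {g : unitaryGroupOfForm (starRingEnd ℂ) Jw | IsUnit (1 + (((g : GL (Fin N) ℂ)) : Matrix (Fin N) (Fin N) ℂ))} := by
  rw [image_cayleyChartC_eq subset_rfl]
  ext g
  exact ⟨fun h => h.1, fun h => ⟨h, cayleyInvC_mem_cayleySourceC h⟩⟩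

variable [MeasurableSpace (GL (Fin N) ℂ)] [BorelSpace (GL (Fin N) ℂ)]

/-- The Cayley-singular locus `{g | 1 + g singular}` is closed, hence measurable. [cite: Weyl1939, Ch. II §10] -/
theorem measurableSet_setOf_not_isUnit_one_add :
    MeasurableSet {g : unitaryGroupOfForm (starRingEnd ℂ) Jw | ¬ IsUnit (1 + (((g : GL (Fin N) ℂ)) : Matrix (Fin N) (Fin N) ℂ))} := by
  have ho : IsOpen {g : unitaryGroupOfForm (starRingEnd ℂ) Jw | IsUnit (1 + (((g : GL (Fin N) ℂ)) : Matrix (Fin N) (Fin N) ℂ))} :=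
    (isOpen_setOf_isUnit_one_add (R := Matrix (Fin N) (Fin N) ℂ)).preimage (Units.continuous_val.comp continuous_subtype_val)
  have : {g : unitaryGroupOfForm (starRingEnd ℂ) Jw | ¬ IsUnit (1 + (((g : GL (Fin N) ℂ)) : Matrix (Fin N) (Fin N) ℂ))} =
      {g : unitaryGroupOfForm (starRingEnd ℂ) Jw | IsUnit (1 + (((g : GL (Fin N) ℂ)) : Matrix (Fin N) (Fin N) ℂ))}ᶜ := by ext g; simp
  rw [this]
  exact ho.measurableSet.compl

/-- **THE CAYLEY-SINGULAR LOCUS IS NULL**: `μ {g ∈ U(Jw)(ℂ) | 1 + g singular} = 0` for EVERY left-invariant measure `μ` finite on compacta — the counting argument with the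
central circle `ζ·1` (each `g` has at most `N` eigenvalues `−ζ`). [cite: Weyl1939, Ch. II §10] [cite: Helgason2000, Ch. I §1 Thm. 1.14 p. 96] -/
theorem measure_setOf_not_isUnit_one_add_eq_zero (μ : Measure (unitaryGroupOfForm (starRingEnd ℂ) Jw)) [IsFiniteMeasureOnCompacts μ] [μ.IsMulLeftInvariant] :
    μ {g : unitaryGroupOfForm (starRingEnd ℂ) Jw | ¬ IsUnit (1 + (((g : GL (Fin N) ℂ)) : Matrix (Fin N) (Fin N) ℂ))} = 0 := by
  haveI := locallyCompactSpace_unitaryGroupOfForm_complex (n := Fin N) Jw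
  haveI := secondCountableTopology_unitaryGroupOfForm_complex (n := Fin N) Jw
  set Z := {g : unitaryGroupOfForm (starRingEnd ℂ) Jw | ¬ IsUnit (1 + (((g : GL (Fin N) ℂ)) : Matrix (Fin N) (Fin N) ℂ))} with hZ
  have hZm : MeasurableSet Z := measurableSet_setOf_not_isUnit_one_add
  -- σ-compactness: it suffices to treat `Z ∩ C` for `C` compact
  suffices h : ∀ C : Set (unitaryGroupOfForm (starRingEnd ℂ) Jw), IsCompact C → μ (Z ∩ C) = 0 by
    have hcov : Z = ⋃ n, Z ∩ compactCovering (unitaryGroupOfForm (starRingEnd ℂ) Jw) n := by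
      rw [← Set.inter_iUnion, iUnion_compactCovering, Set.inter_univ]
    rw [hcov]
    exact measure_iUnion_null fun n => h _ (isCompact_compactCovering _ n)
  intro C hC
  -- the central circle
  let u : Circle → unitaryGroupOfForm (starRingEnd ℂ) Jw := fun ζ => ⟨circleDiagonal N (fun _ => ζ), circleDiagonal_const_mem_unitaryGroupOfForm ζ⟩
  have hu_cont : Continuous u :=
    (continuous_circleDiagonal N |>.comp (continuous_pi fun _ => continuous_id)).subtype_mk _
  have hu_mul : ∀ ζ ζ' : Circle, u (ζ * ζ') = u ζ * u ζ' := fun ζ ζ' => by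
    apply Subtype.ext
    change circleDiagonal N (fun _ => ζ * ζ') = circleDiagonal N (fun _ => ζ) * circleDiagonal N (fun _ => ζ')
    rw [← map_mul]; rfl
  have hu_one : u 1 = 1 := by
    apply Subtype.ext
    change circleDiagonal N (fun _ => (1 : Circle)) = 1
    have : (fun _ : Fin N => (1 : Circle)) = 1 := rfl
    rw [this, map_one]
  -- the compact `S¹ · C`
  set C' : Set (unitaryGroupOfForm (starRingEnd ℂ) Jw) := (fun p : Circle × unitaryGroupOfForm (starRingEnd ℂ) Jw => u p.1 * p.2) '' (Set.univ ×ˢ C) with hC'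
  have hC'c : IsCompact C' := (isCompact_univ.prod hC).image ((hu_cont.comp continuous_fst).mul continuous_snd)
  have hC'm : MeasurableSet C' := hC'c.isClosed.measurableSet
  have hC'top : μ C' ≠ ⊤ := hC'c.measure_lt_top.ne
  -- the translates `A ζ = (u ζ⁻¹ · )⁻¹ (Z ∩ C)`
  let A : Circle → Set (unitaryGroupOfForm (starRingEnd ℂ) Jw) := fun ζ => (fun g => u ζ⁻¹ * g) ⁻¹' (Z ∩ C)
  have hAm : ∀ ζ, MeasurableSet (A ζ) := fun ζ => (hZm.inter hC.isClosed.measurableSet).preimage (measurable_const_mul _)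
  have hAμ : ∀ ζ, μ (A ζ) = μ (Z ∩ C) := fun ζ => measure_preimage_mul μ _ _
  have hAsub : ∀ ζ, A ζ ⊆ C' := by
    intro ζ g hg
    refine ⟨(ζ, u ζ⁻¹ * g), ⟨Set.mem_univ _, hg.2⟩, ?_⟩
    change u ζ * (u ζ⁻¹ * g) = g
    rw [← mul_assoc, ← hu_mul, mul_inv_cancel, hu_one, one_mul]
  have hover : ∀ (T₀ : Finset Circle) (g : unitaryGroupOfForm (starRingEnd ℂ) Jw), (T₀.filter fun ζ => g ∈ A ζ).card ≤ N := by
    intro T₀ g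
    refine le_trans (Finset.card_le_card (Finset.monotone_filter_right T₀ fun ζ _ hζ => ?_))
      (card_filter_not_isUnit_smul_one_add_le (fun ζ : Circle => (ζ : ℂ)) Subtype.val_injective (((g : GL (Fin N) ℂ)) : Matrix (Fin N) (Fin N) ℂ) T₀)
    -- `g ∈ A ζ ⇒ det(ζ·1 + g) = 0`
    have h1 : ¬ IsUnit (1 + ((((u ζ⁻¹ * g : unitaryGroupOfForm (starRingEnd ℂ) Jw)) : GL (Fin N) ℂ) : Matrix (Fin N) (Fin N) ℂ)) := hζ.1
    rw [coe_circleDiagonal_const_mul] at h1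
    rw [Circle.coe_inv] at h1
    exact not_isUnit_smul_one_add_of_not_isUnit (Circle.coe_ne_zero ζ) h1
  -- count
  refine eq_zero_of_forall_nat_mul_le (ENNReal.mul_ne_top (ENNReal.natCast_ne_top N) hC'top) fun k => ?_
  obtain ⟨T₀, -, hT₀⟩ := univ_circle_infinite.exists_subset_card_eq k
  calc (k : ℝ≥0∞) * μ (Z ∩ C) = ∑ ζ ∈ T₀, μ (A ζ) := by rw [Finset.sum_congr rfl fun ζ _ => hAμ ζ, Finset.sum_const, hT₀, nsmul_eq_mul]
    _ ≤ (N : ℝ≥0∞) * μ C' := sum_measure_le_mul_of_card_filter_le μ T₀ A hC'm (fun ζ _ => hAm ζ) (fun ζ _ => hAsub ζ) N fun g => hover T₀ g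

/-- **THE CHART IMAGE HAS NULL COMPLEMENT**: `μ (ĉ '' cayleySourceC)ᶜ = 0` for every left-invariant `μ` finite on compacta. [cite: Weyl1939, Ch. II §10]
[cite: Helgason2000, Ch. I §1 Thm. 1.14 p. 96] -/
theorem measure_compl_image_cayleySourceC_eq_zero (μ : Measure (unitaryGroupOfForm (starRingEnd ℂ) Jw)) [IsFiniteMeasureOnCompacts μ] [μ.IsMulLeftInvariant] :
    μ (cayleyChartC N Jw '' cayleySourceC N Jw)ᶜ = 0 := by
  rw [image_cayleyChartC_cayleySourceC]
  have : {g : unitaryGroupOfForm (starRingEnd ℂ) Jw | IsUnit (1 + (((g : GL (Fin N) ℂ)) : Matrix (Fin N) (Fin N) ℂ))}ᶜ =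
      {g : unitaryGroupOfForm (starRingEnd ℂ) Jw | ¬ IsUnit (1 + (((g : GL (Fin N) ℂ)) : Matrix (Fin N) (Fin N) ℂ))} := by ext g; simp
  rw [this]
  exact measure_setOf_not_isUnit_one_add_eq_zero μ

/-- Hence `μ(univ) = μ(ĉ '' cayleySourceC)`. [cite: Helgason2000, Ch. I §1 Thm. 1.14 p. 96] -/
theorem measure_univ_eq_measure_image_cayleySourceC (μ : Measure (unitaryGroupOfForm (starRingEnd ℂ) Jw)) [IsFiniteMeasureOnCompacts μ] [μ.IsMulLeftInvariant] :
    μ Set.univ = μ (cayleyChartC N Jw '' cayleySourceC N Jw) := by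
  rw [← measure_add_measure_compl (isOpen_image_cayleyChartC subset_rfl isOpen_cayleySourceC).measurableSet, measure_compl_image_cayleySourceC_eq_zero μ, add_zero]

end Group

/-! ## §4 The complement of the chart source in `𝔲(Jw)` is Lebesgue-null -/

section LieAlgebra

variable {N : ℕ} {Jw : Matrix (Fin N) (Fin N) ℂ}

/-- `i·1 ∈ 𝔲(Jw)` for every `Jw` (`(i·1)ᴴ Jw + Jw (i·1) = −i Jw + i Jw = 0`). [cite: Weyl1939, Ch. II §10] -/
theorem I_smul_one_mem_skewC : (Complex.I • (1 : Matrix (Fin N) (Fin N) ℂ)) ∈ skewC N Jw := by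
  rw [mem_skewC_iff, Matrix.conjTranspose_smul, Matrix.conjTranspose_one, Matrix.smul_mul, Matrix.one_mul, Matrix.mul_smul, Matrix.mul_one, Complex.star_def,
    Complex.conj_I, neg_smul, neg_add_cancel]

/-- The matrix of `t • (i·1) + X` is `(t i) • 1 + X`. [cite: Weyl1939, Ch. II §10] -/
theorem coe_smul_I_add (t : ℝ) (X : skewC N Jw) :
    ((t • (⟨Complex.I • (1 : Matrix (Fin N) (Fin N) ℂ), I_smul_one_mem_skewC⟩ : skewC N Jw) + X : skewC N Jw) : Matrix (Fin N) (Fin N) ℂ) =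
      ((t : ℂ) * Complex.I) • (1 : Matrix (Fin N) (Fin N) ℂ) + (X : Matrix (Fin N) (Fin N) ℂ) := by
  rw [Submodule.coe_add, Submodule.coe_smul, ← smul_smul, Complex.coe_smul]

variable [MeasurableSpace (skewC N Jw)] [BorelSpace (skewC N Jw)]

/-- A closed set of the shape `{X | 1 + X singular}` or `{X | 1 − X singular}` read through a continuous matrix-valued map is measurable. [cite: Weyl1939, Ch. II §10] -/
theorem measurableSet_setOf_not_isUnit {f : skewC N Jw → Matrix (Fin N) (Fin N) ℂ} (hf : Continuous f) : MeasurableSet {X : skewC N Jw | ¬ IsUnit (f X)} := by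
  have ho : IsOpen {X : skewC N Jw | IsUnit (f X)} := by
    have : {X : skewC N Jw | IsUnit (f X)} = f ⁻¹' {M : Matrix (Fin N) (Fin N) ℂ | IsUnit M} := rfl
    rw [this]
    refine IsOpen.preimage hf ?_
    have e : {M : Matrix (Fin N) (Fin N) ℂ | IsUnit M} = {M : Matrix (Fin N) (Fin N) ℂ | IsUnit (1 + (M - 1))} := by ext M; simp
    rw [e]
    exact (isOpen_setOf_isUnit_one_add (R := Matrix (Fin N) (Fin N) ℂ)).preimage (continuous_id.sub continuous_const)
  have : {X : skewC N Jw | ¬ IsUnit (f X)} = {X : skewC N Jw | IsUnit (f X)}ᶜ := by ext X; simp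
  rw [this]
  exact ho.measurableSet.compl

/-- **THE TRANSLATION COUNT ON `𝔲(Jw)`**: for a translation-invariant measure `lam` finite on compacta and a continuous «singular-locus» predicate of the shape
`X ↦ ¬ IsUnit (c • 1 + ε X)` transforming under `X ↦ X + t·i·1` through an injective `φ`, the locus is `lam`-null.  Stated concretely for the two loci
`{1 + X singular}` (`ε = 1`, `φ t = 1 + t i`) and `{1 − X singular}` (`ε = −1`, `φ t = 1 − t i`) in the next two theorems; this is their common core.
[cite: Weyl1939, Ch. II §10] [cite: Knapp2002, VIII §2] -/
theorem measure_eq_zero_of_translate_count (lam : Measure (skewC N Jw)) [IsFiniteMeasureOnCompacts lam] [lam.IsAddLeftInvariant]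
    {Z : Set (skewC N Jw)} (hZm : MeasurableSet Z) (φ : ℝ → ℂ) (hφ : Function.Injective φ) (G : skewC N Jw → Matrix (Fin N) (Fin N) ℂ)
    (hZ : ∀ (t : ℝ) (X : skewC N Jw), t • (⟨Complex.I • (1 : Matrix (Fin N) (Fin N) ℂ), I_smul_one_mem_skewC⟩ : skewC N Jw) + X ∈ Z →
      ¬ IsUnit (φ t • (1 : Matrix (Fin N) (Fin N) ℂ) + G X)) :
    lam Z = 0 := by
  haveI : FiniteDimensional ℝ (Matrix (Fin N) (Fin N) ℂ) := finiteDimensional_matrixC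
  set e : skewC N Jw := ⟨Complex.I • (1 : Matrix (Fin N) (Fin N) ℂ), I_smul_one_mem_skewC⟩ with he
  -- σ-compactness of the finite-dimensional `𝔲(Jw)`
  suffices h : ∀ C : Set (skewC N Jw), IsCompact C → lam (Z ∩ C) = 0 by
    have hcov : Z = ⋃ n, Z ∩ compactCovering (skewC N Jw) n := by
      rw [← Set.inter_iUnion, iUnion_compactCovering, Set.inter_univ]
    rw [hcov]
    exact measure_iUnion_null fun n => h _ (isCompact_compactCovering _ n)
  intro C hC
  set C' : Set (skewC N Jw) := (fun p : ℝ × skewC N Jw => -(p.1 • e) + p.2) '' (Set.Icc (0 : ℝ) 1 ×ˢ C) with hC'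
  have hC'c : IsCompact C' := (isCompact_Icc.prod hC).image ((continuous_fst.smul continuous_const).neg.add continuous_snd)
  have hC'm : MeasurableSet C' := hC'c.isClosed.measurableSet
  have hC'top : lam C' ≠ ⊤ := hC'c.measure_lt_top.ne
  let A : ℝ → Set (skewC N Jw) := fun t => (fun X => t • e + X) ⁻¹' (Z ∩ C)
  have hAm : ∀ t, MeasurableSet (A t) := fun t => (hZm.inter hC.isClosed.measurableSet).preimage (measurable_const_add _)
  have hAμ : ∀ t, lam (A t) = lam (Z ∩ C) := fun t => measure_preimage_add lam _ _
  have hAsub : ∀ t ∈ Set.Icc (0 : ℝ) 1, A t ⊆ C' := by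
    intro t ht X hX
    refine ⟨(t, t • e + X), ⟨ht, hX.2⟩, ?_⟩
    change -(t • e) + (t • e + X) = X
    rw [neg_add_cancel_left]
  have hover : ∀ (T₀ : Finset ℝ) (X : skewC N Jw), (T₀.filter fun t => X ∈ A t).card ≤ N := by
    intro T₀ X
    refine le_trans (Finset.card_le_card (Finset.monotone_filter_right T₀ fun t _ ht => ?_)) (card_filter_not_isUnit_smul_one_add_le φ hφ (G X) T₀)
    exact hZ t X ht.1
  refine eq_zero_of_forall_nat_mul_le (ENNReal.mul_ne_top (ENNReal.natCast_ne_top N) hC'top) fun k => ?_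
  obtain ⟨T₀, hT₀s, hT₀⟩ := (Set.Icc_infinite (zero_lt_one' ℝ)).exists_subset_card_eq k
  calc (k : ℝ≥0∞) * lam (Z ∩ C) = ∑ t ∈ T₀, lam (A t) := by rw [Finset.sum_congr rfl fun t _ => hAμ t, Finset.sum_const, hT₀, nsmul_eq_mul]
    _ ≤ (N : ℝ≥0∞) * lam C' :=
        sum_measure_le_mul_of_card_filter_le lam T₀ A hC'm (fun t _ => hAm t) (fun t ht => hAsub t (hT₀s ht)) N fun X => hover T₀ X

/-- `{X ∈ 𝔲(Jw) | 1 + X singular}` is `lam`-null for every translation-invariant `lam` finite on compacta. [cite: Weyl1939, Ch. II §10] -/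
theorem measure_setOf_not_isUnit_one_add_skewC_eq_zero (lam : Measure (skewC N Jw)) [IsFiniteMeasureOnCompacts lam] [lam.IsAddLeftInvariant] :
    lam {X : skewC N Jw | ¬ IsUnit (1 + (X : Matrix (Fin N) (Fin N) ℂ))} = 0 := by
  refine measure_eq_zero_of_translate_count lam (measurableSet_setOf_not_isUnit (continuous_const.add continuous_subtype_val))
    (fun t : ℝ => 1 + (t : ℂ) * Complex.I) (fun t t' h => by simpa using h) (fun X => (X : Matrix (Fin N) (Fin N) ℂ)) fun t X hX => ?_
  have h1 : ¬ IsUnit (1 + ((t • (⟨Complex.I • (1 : Matrix (Fin N) (Fin N) ℂ), I_smul_one_mem_skewC⟩ : skewC N Jw) + X : skewC N Jw) : Matrix (Fin N) (Fin N) ℂ)) := hX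
  rw [coe_smul_I_add] at h1
  have e : (1 + (t : ℂ) * Complex.I) • (1 : Matrix (Fin N) (Fin N) ℂ) + (X : Matrix (Fin N) (Fin N) ℂ) =
      1 + (((t : ℂ) * Complex.I) • (1 : Matrix (Fin N) (Fin N) ℂ) + (X : Matrix (Fin N) (Fin N) ℂ)) := by
    simp only [add_smul, one_smul]; abel
  rw [e]; exact h1

/-- `{X ∈ 𝔲(Jw) | 1 − X singular}` is `lam`-null for every translation-invariant `lam` finite on compacta. [cite: Weyl1939, Ch. II §10] -/
theorem measure_setOf_not_isUnit_one_sub_skewC_eq_zero (lam : Measure (skewC N Jw)) [IsFiniteMeasureOnCompacts lam] [lam.IsAddLeftInvariant] :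
    lam {X : skewC N Jw | ¬ IsUnit (1 - (X : Matrix (Fin N) (Fin N) ℂ))} = 0 := by
  refine measure_eq_zero_of_translate_count lam (measurableSet_setOf_not_isUnit (continuous_const.sub continuous_subtype_val))
    (fun t : ℝ => 1 - (t : ℂ) * Complex.I) (fun t t' h => by simpa using h) (fun X => -(X : Matrix (Fin N) (Fin N) ℂ)) fun t X hX => ?_
  have h1 : ¬ IsUnit (1 - ((t • (⟨Complex.I • (1 : Matrix (Fin N) (Fin N) ℂ), I_smul_one_mem_skewC⟩ : skewC N Jw) + X : skewC N Jw) : Matrix (Fin N) (Fin N) ℂ)) := hX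
  rw [coe_smul_I_add] at h1
  have e : (1 - (t : ℂ) * Complex.I) • (1 : Matrix (Fin N) (Fin N) ℂ) + -(X : Matrix (Fin N) (Fin N) ℂ) =
      1 - (((t : ℂ) * Complex.I) • (1 : Matrix (Fin N) (Fin N) ℂ) + (X : Matrix (Fin N) (Fin N) ℂ)) := by
    simp only [sub_smul, one_smul]; abel
  rw [e]; exact h1

/-- **THE COMPLEMENT OF THE CHART SOURCE IS NULL**: `lam (cayleySourceC)ᶜ = 0` for every translation-invariant `lam` finite on compacta on `𝔲(Jw)` — in particular
for the canonical Lebesgue measure `lieStdLebesgueC` (under `lieGramDetC ≠ 0`). [cite: Weyl1939, Ch. II §10] [cite: Helgason2000, Ch. I §1 Thm. 1.14 p. 96] -/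
theorem measure_compl_cayleySourceC_eq_zero (lam : Measure (skewC N Jw)) [IsFiniteMeasureOnCompacts lam] [lam.IsAddLeftInvariant] :
    lam (cayleySourceC N Jw)ᶜ = 0 := by
  have hsub : (cayleySourceC N Jw)ᶜ ⊆ {X : skewC N Jw | ¬ IsUnit (1 + (X : Matrix (Fin N) (Fin N) ℂ))} ∪ {X : skewC N Jw | ¬ IsUnit (1 - (X : Matrix (Fin N) (Fin N) ℂ))} := by
    intro X hX
    rw [Set.mem_compl_iff, mem_cayleySourceC_iff, not_and_or] at hX
    exact hX
  exact measure_mono_null hsub (measure_union_null (measure_setOf_not_isUnit_one_add_skewC_eq_zero lam) (measure_setOf_not_isUnit_one_sub_skewC_eq_zero lam))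

/-- Hence `∫_{source} f dλ = ∫_{𝔲(Jw)} f dλ`. [cite: Helgason2000, Ch. I §1 Thm. 1.14 p. 96] -/
theorem setLIntegral_cayleySourceC_eq (lam : Measure (skewC N Jw)) [IsFiniteMeasureOnCompacts lam] [lam.IsAddLeftInvariant] (f : skewC N Jw → ℝ≥0∞) :
    ∫⁻ X in cayleySourceC N Jw, f X ∂lam = ∫⁻ X, f X ∂lam := by
  rw [Measure.restrict_eq_self_of_ae_mem]
  exact mem_ae_iff.2 (measure_compl_cayleySourceC_eq_zero lam)

end LieAlgebra

end UnitaryArchLocalTopForm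

end Literature.NumberTheory.Weil1964

end
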